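import Literature.NumberTheory.LFunctions.Zhang2022.KnifeEdgeLenZDegreePsi
import Literature.NumberTheory.LFunctions.Zhang2022.SkeletonMeanValue
import Literature.NumberTheory.GaussSums.GaussSumMonomialFourier

/-!
# Zhang (2022), rung F-S3 (Landau–Siegel programme, §D edge len = E*-len⁺): card `z-degree-toeplitz-band` —
# the F2-CONVERSION LAYER (Sketch v2.3): graded Lemma 8.1, right-edge vanishing (statements), and the FAMILY GAUSS
# MOMENT `Σ_{ψ ≠ ψ₀} τ(ψ̄)^k ψ(m)ψ̄(n) = (p−1)·Kl_k(m n̄; p) + (−1)^{k+1}` (PROVED)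

Y. Zhang, *Discrete mean estimates and the Landau–Siegel zero*, arXiv:2211.02515v1 [Zhang2022LandauSiegel] —
an unrefereed manuscript under adjudication. **WHAT THIS IS NOT: not a claim about Theorems 1–2 of
arXiv:2211.02515, about Landau–Siegel zeros, or about Parity. The programme SEARCHES and TYPES; no claim about
Landau–Siegel zeros, Theorems 1–2 of arXiv:2211.02515 or a repaired Margin232 until a kernel theorem says so.
`GradedLemma81`, `ThetaGradedNegligible` are bare `Prop`s (CLAIM-shaped statements asserted by no one);
`FamilyGaussMoment` is a `Prop` PROVED here (`familyGaussMoment_holds`) from the tree's Katz §4.0 table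
(`Literature.NumberTheory.GaussSums.sum_ne_one_gaussSum_stdAddChar_pow_mul_inv`).**

SOURCE OF THE DECLARATIONS (typed verbatim; the typer adds only proofs and the bridge to the tree's hyper-Kloosterman
sum): card `z-degree-toeplitz-band` (ls-knife-len-idea-1), Sketch v2.3 `knife/len/idea-1/Sketch-z-degree-toeplitz.lean`
sha16 fa42c12669c757f0 §«v2.3 · F2-conversion layer», and the author's `F2-conversion-note.md` (2026-08-27T02:18:20Z):
Zhang converts a discrete mean over `ρ ∈ 𝔷(ψ)` by the residue theorem on the rectangle of Lemma 8.1 [§8 p. 16] and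
the reflection `s' = 1 − s̄` (tree `Lemma81.neg_Itilde_neg_eq_conj`), landing on the right edge `𝔍(1)` where `1/L(s,ψ)`
and `L(s+β_j,ψ)` are exact Dirichlet series and the only Gauss sum is the `τ(ψ̄)` of `Z(s,ψ)⁻¹` [(2.4)]. With the
grading unit `Z(s,ψ)^e` inserted the reflection sends `e ↦ −e` (`Z(s,ψ)Z(1−s,ψ̄) = 1`), the right-edge integrand
`𝔠·Z^e` has net `Z`-power `e − 1`, and the family sum over `ψ (mod p)` meets `τ(ψ̄)^{1−e}`, whose average against
`ψ(m)ψ̄(n)` is a hyper-Kloosterman sum of `1 − e` variables (Katz 1988 Ch. 4 §4.0, tree `GaussSumMonomialFourier`).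
So the degree-`d` table of the card is `Θ^{(d)} + conj Θ^{(−d)}`; for `|d| = 2` one half is negligible (net `Z^{≥1}`,
§7 (7.4)) and the other is a `Kl₃`-correlation sum — the object K1″ (`KnifeEdge.TauTwoLivePsiZhang`) must evaluate.

CONTENTS. Part 1: `thetaGraded` (`Θ^{(e)}`; `thetaGraded_zero : Θ^{(0)} = Θ₁` proved), `lhsGraded` (`lhsGraded_zero :
= lhs81` proved), `GradedLemma81` (statement; `lemma81_of_gradedLemma81` proved: its `e = 0` instance is the tree's
`Skeleton.Lemma81`), `ThetaGradedNegligible` (statement). Part 2 (namespace `KnifeEdgeLenZDegree`, Mathlib + tree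
`GaussSums`): the card's unit-tuple hyper-Kloosterman sum `hyperKloosterman k p a`, its identification with the tree's
`GaussSums.hyperKloosterman k e(·/p) a` (`hyperKloosterman_eq`, proved), `FamilyGaussMoment` (statement verbatim) and
**`familyGaussMoment_holds`** (proved: reindex `ψ ↦ ψ̄`, Katz's line 2 minus the trivial character).

## References
* Y. Zhang, arXiv:2211.02515v1 (2022), §2 (2.4), (2.11); §7 Prop. 7.1, p. 14, (7.4); §8 Lemma 8.1 p. 16.
  [cite: Zhang2022LandauSiegel, §7 Prop 7.1 p.14 (7.4), §8 Lemma 8.1 p.16, (2.4), (2.11)]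
* N. M. Katz, *Gauss Sums, Kloosterman Sums, and Monodromy Groups* (1988), Ch. 4 §4.0 pp. 42–44. [cite: Katz1988, Ch. 4 §4.0 p.43]
-/

open Complex Real ComplexConjugate

noncomputable section

/-! ### Part 1 — the graded mean-value layer: `Θ^{(e)}`, graded Lemma 8.1, right-edge vanishing (statements) -/

namespace Literature.NumberTheory.LFunctions.Zhang2022.KnifeEdge

open Repair Skeleton

variable (c' : ℝ) {D : ℕ} [NeZero D] (χ : DirichletCharacter ℂ D)

/-- **`Θ^{(e)}(𝐚₁,𝐚₂) = Σ_{ψ∈Ψ₁} (1/2πi)∫_{𝔍(1)} 𝔠(s,ψ)·Z(s,ψ)^e·A(𝐚₁;s,ψ)A(𝐚₂;1−s,ψ̄)ω(s)ds`** — Zhang's `Θ₁`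
(tree `Skeleton.Theta1`, Prop. 7.1) with the grading unit `Z(s,ψ)^e` inserted; `Θ^{(0)} = Θ₁` (`thetaGraded_zero`).
[cite: Zhang2022LandauSiegel, §7 Prop 7.1, (2.4)] -/
def thetaGraded (e : ℤ) (a₁ a₂ : ℕ → ℂ) : ℂ :=
  ∑ x ∈ finsetOf (PsiOne χ), Lemma81.segInt (t0 D) (ell1 D) 1 fun s =>
    frakcW c' x s * GammaFactor.Zfac x.ψ s ^ e * Apoly x a₁ s * ApolyBar x a₂ (1 - s) * omegaW D s

/-- **The graded left side `Σ_{(ψ,ρ)∈idx} 𝔠*(ρ,ψ)·Z(ρ,ψ)^e·A(𝐚₁;ρ,ψ)A(𝐚₂;1−ρ,ψ̄)ω(ρ)`** (tree `Skeleton.lhs81` at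
`e = 0`, `lhsGraded_zero`); this is the holomorphic pairing behind `zDegMeanPsi` (on the line
`A(𝐚₂;1−ρ,ψ̄) = conj A(𝐚̄₂;ρ,ψ)`). [cite: Zhang2022LandauSiegel, §8 Lemma 8.1] -/
def lhsGraded (e : ℤ) (a₁ a₂ : ℕ → ℂ) : ℂ :=
  ∑ i ∈ idx χ, cstar c' D i.1 i.2 * GammaFactor.Zfac i.1.ψ i.2 ^ e * Apoly i.1 a₁ i.2 *
    ApolyBar i.1 a₂ (1 - i.2) * omegaW D i.2

omit [NeZero D] in
/-- `Θ^{(0)} = Θ₁` (definitional sanity check, proved). [cite: Zhang2022LandauSiegel, §7 Prop 7.1] -/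
theorem thetaGraded_zero (a₁ a₂ : ℕ → ℂ) : thetaGraded c' χ 0 a₁ a₂ = Theta1 c' χ a₁ a₂ := by
  unfold thetaGraded Theta1
  simp

omit [NeZero D] in
/-- The graded left side at `e = 0` is the left side of Lemma 8.1 (proved). [cite: Zhang2022LandauSiegel, §8 Lemma 8.1] -/
theorem lhsGraded_zero (a₁ a₂ : ℕ → ℂ) : lhsGraded c' χ 0 a₁ a₂ = lhs81 c' χ a₁ a₂ := by
  unfold lhsGraded lhs81
  simp

/-- **GRADED LEMMA 8.1 (statement, OPEN — asserted by no one):** for `𝐚₁, 𝐚₂` satisfying (7.2) and every `e : ℤ`,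
`Σ_{ψ,ρ} 𝔠*Z^e A A ω = Θ^{(e)}(𝐚₁,𝐚₂) + conj Θ^{(−e)}(𝐚̄₂,𝐚̄₁) + o(𝔓)` — the reflection `s' = 1 − s̄` of Lemma 8.1 maps
`Z(s,ψ)^e` to `Z(s',ψ)^{−e}` because `Z(s,ψ)Z(1−s,ψ̄) = 1`. `e = 0` is the tree's `Skeleton.Lemma81`
(`lemma81_of_gradedLemma81`). Why it might fail: only through the side conditions of Lemma 5.9 / Prop. 2.2 (growth of
`Z^e` on the horizontal connectors, harmless for `|e| ≤ 3`). [cite: Zhang2022LandauSiegel, §8 Lemma 8.1 p.16, (2.11)] -/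
def GradedLemma81 : Prop :=
  ∀ e : ℤ, ∀ B : ℝ, ∀ ε : ℝ, 0 < ε → ForAllLarge fun D _ χ => AssumptionA D χ →
    ∀ a₁ a₂ : ℕ → ℂ, Adm72 D B a₁ → Adm72 D B a₂ →
      ‖lhsGraded c' χ e a₁ a₂ -
          (thetaGraded c' χ e a₁ a₂ +
            conj (thetaGraded c' χ (-e) (fun n => conj (a₂ n)) (fun n => conj (a₁ n))))‖
        ≤ ε * frakP D

/-- The `e = 0` instance of the graded Lemma 8.1 is Zhang's Lemma 8.1 as typed (`Skeleton.Lemma81`) (proved).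
[cite: Zhang2022LandauSiegel, §8 Lemma 8.1 p.16] -/
theorem lemma81_of_gradedLemma81 (h : GradedLemma81 c') : Lemma81 c' := by
  intro B ε hε
  refine (h 0 B ε hε).mono fun D _ χ _ _ hS hA a₁ a₂ h₁ h₂ => ?_
  have := hS hA a₁ a₂ h₁ h₂
  simpa only [lhsGraded_zero, thetaGraded_zero, neg_zero] using this

/-- **RIGHT-EDGE VANISHING (statement, OPEN — asserted by no one):** for `e ≥ 2` the integrand
`𝔠(s,ψ)Z(s,ψ)^e A(𝐚₁;s)A(𝐚₂;1−s)ω` has net `Z`-power `e − 1 ≥ 1`, `|Z(s,ψ)| = (p t)^{1/2−σ}` and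
`A(𝐚₂;1−s,ψ̄) ≪ (PT⁻²)^σ`, so moving `𝔍(1)` to `𝔍(𝓛⁹)` as in §7 (7.4) gives `Θ^{(e)} = o(𝔓)`. Hence a degree-`d` table
with `|d| ≥ 2` is carried entirely by `conj Θ^{(−|d|)}`, whose family sum is the `Kl_{1+|d|}` moment of Part 2.
[cite: Zhang2022LandauSiegel, §7 p.14 (7.4)] -/
def ThetaGradedNegligible : Prop :=
  ∀ e : ℤ, 2 ≤ e → ∀ B : ℝ, ∀ ε : ℝ, 0 < ε → ForAllLarge fun D _ χ => AssumptionA D χ →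
    ∀ a₁ a₂ : ℕ → ℂ, Adm72 D B a₁ → Adm72 D B a₂ → ‖thetaGraded c' χ e a₁ a₂‖ ≤ ε * frakP D

end Literature.NumberTheory.LFunctions.Zhang2022.KnifeEdge

/-! ### Part 2 — the family Gauss moment (Mathlib + tree `GaussSums`; PROVED) -/

namespace KnifeEdgeLenZDegree

open Finset

/-- **The card's hyper-Kloosterman sum `Kl_k(a;p) = Σ_{x₁⋯x_k = a, xᵢ ∈ (ℤ/p)ˣ} e((x₁+⋯+x_k)/p)`** (`Kl₁(a) = e(a/p)`,
`Kl₂` = Kloosterman, `Kl₃` = the sum met by the `|d| = 2` table), summed over UNIT tuples as in Katz §4.0; equal to the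
tree's `Literature.NumberTheory.GaussSums.hyperKloosterman k e(·/p) a` (all tuples with product `a`) for a unit `a`
(`hyperKloosterman_eq`). [cite: Katz1988, Ch. 4 §4.0 p.44] -/
def hyperKloosterman (k p : ℕ) [NeZero p] (a : (ZMod p)ˣ) : ℂ :=
  ∑ x ∈ (univ : Finset (Fin k → (ZMod p)ˣ)).filter (fun x => ∏ i, x i = a),
    ZMod.stdAddChar (∑ i, (x i : ZMod p))

/-- **Unit tuples = all tuples with unit product (proved):** the card's `Kl_k` is the tree's Katz hyper-Kloosterman sum
at `ψ = e(·/p)` — a tuple in `ℤ/p` with product the unit `a` consists of units. [cite: Katz1988, Ch. 4 §4.0 p.44] -/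
theorem hyperKloosterman_eq (k p : ℕ) [NeZero p] (a : (ZMod p)ˣ) :
    hyperKloosterman k p a = Literature.NumberTheory.GaussSums.hyperKloosterman k ZMod.stdAddChar (a : ZMod p) := by
  classical
  unfold hyperKloosterman Literature.NumberTheory.GaussSums.hyperKloosterman
  refine Finset.sum_nbij (fun x i => (x i : ZMod p)) ?_ ?_ ?_ ?_
  · intro x hx
    rw [mem_filter] at hx ⊢
    refine ⟨mem_univ _, ?_⟩
    rw [← Units.coe_prod, hx.2]
  · intro x _ y _ hxy
    funext i
    exact Units.ext (congrFun hxy i)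
  · intro y hy
    rw [mem_coe, mem_filter] at hy
    have hu : ∀ i, IsUnit (y i) := by
      have : IsUnit (∏ i, y i) := hy.2 ▸ a.isUnit
      intro i
      exact isUnit_of_dvd_unit (Finset.dvd_prod_of_mem y (mem_univ i)) this
    refine ⟨fun i => (hu i).unit, ?_, ?_⟩
    · rw [mem_coe, mem_filter]
      refine ⟨mem_univ _, Units.ext ?_⟩
      rw [Units.coe_prod]
      simpa only [IsUnit.unit_spec] using hy.2
    · funext i
      exact (hu i).unit_spec
  · intro x _
    rfl

/-- **FAMILY GAUSS MOMENT (statement verbatim from the card; PROVED below):** for a prime `p`, `k ≥ 1` and units `m, n`,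
`Σ_{ψ (mod p), ψ ≠ ψ₀} τ(ψ̄)^k ψ(m) ψ̄(n) = (p − 1)·Kl_k(m n̄; p) + (−1)^{k+1}`. `k = 1` is Zhang's display
«`Σ* τ(ψ̄)ψ(l)ψ̄(k) = p e(l k̄/p) + O(1)`» (§7 p. 14); `k = 1 + |d|` is what the degree-`d` table meets on the right edge.
Stated over an explicit finset `S` of the non-principal characters to avoid a `Fintype` literal in the statement.
[cite: Zhang2022LandauSiegel, §7 p.14] [cite: Katz1988, Ch. 4 §4.0 p.43] -/
def FamilyGaussMoment : Prop :=
  ∀ p : ℕ, ∀ hp : p.Prime, ∀ k : ℕ, 1 ≤ k → ∀ m n : (ZMod p)ˣ,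
    ∀ S : Finset (DirichletCharacter ℂ p), (∀ ψ, ψ ∈ S ↔ ψ ≠ 1) →
      haveI : NeZero p := ⟨hp.ne_zero⟩
      ∑ ψ ∈ S, gaussSum ψ⁻¹ (ZMod.stdAddChar (N := p)) ^ k * ψ (m : ZMod p) * ψ⁻¹ (n : ZMod p) =
        ((p : ℂ) - 1) * hyperKloosterman k p (m * n⁻¹) + (-1 : ℂ) ^ (k + 1)

/-- **The family Gauss moment holds (proved; also for `k = 0`):** reindex the non-principal characters by `ψ ↦ ψ̄ = ψ⁻¹`,
note `ψ̄⁻¹(m)·ψ̄(n)… = χ((m n̄)⁻¹)` for `χ = ψ̄`, and apply Katz's table line 2 minus the trivial character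
(`GaussSums.sum_ne_one_gaussSum_stdAddChar_pow_mul_inv`) with `hyperKloosterman_eq`. [cite: Katz1988, Ch. 4 §4.0 p.43] -/
theorem familyGaussMoment_holds : FamilyGaussMoment := by
  intro p hp k _ m n S hS
  classical
  haveI : Fact p.Prime := ⟨hp⟩
  have hSe : S = (univ : Finset (DirichletCharacter ℂ p)).erase 1 := by
    ext ψ
    simp [hS ψ]
  subst hSe
  set a : (ZMod p)ˣ := m * n⁻¹ with ha_def
  -- reindex ψ ↦ ψ⁻¹
  have hre : ∑ ψ ∈ (univ : Finset (DirichletCharacter ℂ p)).erase 1,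
        gaussSum ψ⁻¹ (ZMod.stdAddChar (N := p)) ^ k * ψ (m : ZMod p) * ψ⁻¹ (n : ZMod p) =
      ∑ χ ∈ (univ : Finset (DirichletCharacter ℂ p)).erase 1,
        gaussSum χ (ZMod.stdAddChar (N := p)) ^ k * χ (a : ZMod p)⁻¹ := by
    refine Finset.sum_nbij' (fun ψ => ψ⁻¹) (fun χ => χ⁻¹) ?_ ?_ ?_ ?_ ?_
    · intro ψ hψ
      simp only [mem_erase, ne_eq, mem_univ, and_true] at hψ ⊢
      exact fun h => hψ (inv_eq_one.mp h)
    · intro χ hχ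
      simp only [mem_erase, ne_eq, mem_univ, and_true] at hχ ⊢
      exact fun h => hχ (inv_eq_one.mp h)
    · intro ψ _
      exact inv_inv ψ
    · intro χ _
      exact inv_inv χ
    · intro ψ _
      have h1 : ((a : ZMod p))⁻¹ = ((a⁻¹ : (ZMod p)ˣ) : ZMod p) := (ZMod.inv_coe_unit a)
      rw [h1, ha_def, mul_inv_rev, inv_inv, Units.val_mul, map_mul, mul_assoc]
      congr 1
      rw [mul_comm]
      congr 1
      rw [MulChar.inv_apply, Ring.inverse_unit, inv_inv]
  rw [hre, Literature.NumberTheory.GaussSums.sum_ne_one_gaussSum_stdAddChar_pow_mul_inv k a.isUnit,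
    hyperKloosterman_eq, pow_succ]
  ring

end KnifeEdgeLenZDegree

/-! ### Part 3 — the K1″a / K1″b SPLIT as typed glue (author's F2 note §4.2 recommendation (β); critic's C0 clarification
2026-08-27T02:53:24Z, item α2): a ψ-graded slot follows from a DECOMPOSITION of its discrete mean into a «diagonal» part
carrying the named constant and a «wrap-around» part that is `o(𝔞𝔓)`. The two parts are PARAMETERS here (to be
instantiated by the archimedean census: diagonal = the exact class `h·n = r`, wrap = `h·n ≡ r (mod p)`, `h·n ≠ r`);
nothing about them is asserted. -/

namespace Literature.NumberTheory.LFunctions.Zhang2022.KnifeEdge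

open Repair Skeleton

section Split

variable (c' : ℝ)

/-- A `D`-indexed quantity attached to a pair of profile pieces — the currency of a split table (e.g. the diagonal class
or the wrap-around of the `|d| = 2` entry, F2 note §3). [cite: Zhang2022LandauSiegel, §8 (8.5)] -/
abbrev PieceDTable : Type := (f f' g g' : ℝ → ℂ) → (D : ℕ) → [NeZero D] → DirichletCharacter ℂ D → ℂ

/-- **Split of the degree-`d` ψ-graded cross mean (shape, OPEN):** under (A), eventually, for in-class `f, g`,
`τ^ψ_d(conj Q_g, H_f) = T_diag(f,g;D,χ) + T_wrap(f,g;D,χ)` EXACTLY (the F2 bookkeeping: reflection + right edge +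
family Gauss moment + reciprocity; diagonal = exact class, wrap = the rest). [cite: Zhang2022LandauSiegel, §7 Prop 7.1 p.14, §8 Lemma 8.1] -/
def CrossMeanSplit (d : ℕ) (Tdiag Twrap : PieceDTable) : Prop :=
  ∀ (f f' g g' : ℝ → ℂ), InClassPiece f f' → InClassPiece g g' →
    ForAllLarge fun D _ χ => AssumptionA D χ →
      zDegMeanPsi c' χ d (fun x t => conj (profPoly χ x g (⌊bigP D⌋₊ + 1) t))
          (fun x t => profPoly χ x f (⌊bigP D⌋₊ + 1) t) = Tdiag f f' g g' D χ + Twrap f f' g g' D χ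

/-- **K1″a shape (OPEN): the diagonal part carries the named constant,** `T_diag = X(f,g)·𝔞𝔓 + o(𝔞𝔓)` under (A),
eventually — Zhang-type main-term calculus on the exact class (price L in the card). [cite: Zhang2022LandauSiegel, §8 (8.5), §9] -/
def DiagMain (Tdiag : PieceDTable) (X : PairFunctional) : Prop :=
  ∀ (f f' g g' : ℝ → ℂ), InClassPiece f f' → InClassPiece g g' → ∀ ε : ℝ, 0 < ε →
    ForAllLarge fun D _ χ => AssumptionA D χ →
      ‖Tdiag f f' g g' D χ - X f f' g g' * frakA χ * frakP D‖ ≤ ε * frakA χ * frakP D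

/-- **K1″b shape (OPEN): the wrap-around CANCELS,** `T_wrap = o(𝔞𝔓)` under (A), eventually — for the `|d| = 2` table a
bilinear `Kl₃` estimate to prime moduli (in print box-wise only: `kowalskiMichelSawin2017_theorem11_hyper`/`_theorem13_hyper`,
`FKM2014.fouvryKowalskiMichel2014_theorem17_hyper`; price L–XL in the card). [cite: Zhang2022LandauSiegel, §7 (7.11)–(7.15)] -/
def WrapNegligible (Twrap : PieceDTable) : Prop :=
  ∀ (f f' g g' : ℝ → ℂ), InClassPiece f f' → InClassPiece g g' → ∀ ε : ℝ, 0 < ε →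
    ForAllLarge fun D _ χ => AssumptionA D χ → ‖Twrap f f' g g' D χ‖ ≤ ε * frakA χ * frakP D

variable {c'}

/-- **THE SPLIT GLUE (proved): split ∧ K1″a ∧ K1″b ⇒ the slot.** `CrossMeanSplit c′ d T_diag T_wrap`, `DiagMain T_diag X`
and `WrapNegligible T_wrap` give `CrossTablePsi c′ d X` (triangle inequality with `ε/2 + ε/2`); at `d = 2` this is
`TauTwoTablePsi c′ X₂` from K1″a + K1″b. [cite: Zhang2022LandauSiegel, §8 (8.5)] -/
theorem crossTablePsi_of_split {d : ℕ} {Tdiag Twrap : PieceDTable} {X : PairFunctional}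
    (hs : CrossMeanSplit c' d Tdiag Twrap) (hd : DiagMain Tdiag X) (hw : WrapNegligible Twrap) :
    CrossTablePsi c' d X := by
  intro f f' g g' hf hg ε hε
  have hε2 : 0 < ε / 2 := by positivity
  refine (((hs f f' g g' hf hg).and (hd f f' g g' hf hg (ε / 2) hε2)).and (hw f f' g g' hf hg (ε / 2) hε2)).mono
    fun D _ χ _ _ h hA => ?_
  obtain ⟨⟨h1, h2⟩, h3⟩ := h
  rw [h1 hA]
  calc ‖Tdiag f f' g g' D χ + Twrap f f' g g' D χ - X f f' g g' * frakA χ * frakP D‖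
      = ‖(Tdiag f f' g g' D χ - X f f' g g' * frakA χ * frakP D) + Twrap f f' g g' D χ‖ := by ring_nf
    _ ≤ ‖Tdiag f f' g g' D χ - X f f' g g' * frakA χ * frakP D‖ + ‖Twrap f f' g g' D χ‖ := norm_add_le _ _
    _ ≤ ε / 2 * frakA χ * frakP D + ε / 2 * frakA χ * frakP D := add_le_add (h2 hA) (h3 hA)
    _ = ε * frakA χ * frakP D := by ring

/-- … in particular for the NEW table: K1″a ∧ K1″b (with the split) ⇒ `TauTwoTablePsi c′ X₂`. [cite: Zhang2022LandauSiegel, §8 (8.5)] -/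
theorem tauTwoTablePsi_of_split {Tdiag Twrap : PieceDTable} {X₂ : PairFunctional}
    (hs : CrossMeanSplit c' 2 Tdiag Twrap) (hd : DiagMain Tdiag X₂) (hw : WrapNegligible Twrap) :
    TauTwoTablePsi c' X₂ :=
  crossTablePsi_of_split hs hd hw

/-- The trivial split (everything «diagonal», no wrap) — so `DiagMain` with `T_diag :=` the mean itself IS the slot:
the split costs nothing when not used. [cite: Zhang2022LandauSiegel, §8 (8.5)] -/
theorem crossMeanSplit_trivial (d : ℕ) :
    CrossMeanSplit c' d
      (fun f _ g _ D _ χ => zDegMeanPsi c' χ d (fun x t => conj (profPoly χ x g (⌊bigP D⌋₊ + 1) t))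
        (fun x t => profPoly χ x f (⌊bigP D⌋₊ + 1) t))
      (fun _ _ _ _ _ _ _ => 0) :=
  fun _ _ _ _ _ _ => ForAllLarge.of_le 0 fun _ _ _ _ _ _ _ => by simp

end Split

/-! ### Part 4 — the RIGHT-EDGE REDUCTION of the degree-±2 pairing (F2 note §2, «|d| = 2 ⇒ [o(𝔓)] + conj[Kl₃ part]»; PROVED
from the two OPEN Props): under `GradedLemma81` and `ThetaGradedNegligible`, the graded left side at `e = 2` is `conj Θ^{(−2)}` of the
conjugate-swapped data up to `o(𝔓)`, and at `e = −2` it is `Θ^{(−2)}` itself up to `o(𝔓)` — so K1″ lives entirely on `Θ^{(−2)}`, the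
`τ(ψ̄)³`/`Kl₃` half (`familyGaussMoment_holds` with `k = 3`). -/

section RightEdge

variable {c' : ℝ}

/-- **Degree `+2`: the left side is the CONJUGATE `Kl₃` half (proved from the two OPEN Props):**
`‖lhs₂(𝐚₁,𝐚₂) − conj Θ^{(−2)}(𝐚̄₂,𝐚̄₁)‖ ≤ ε𝔓` eventually under (A), for (7.2)-data — `GradedLemma81` at `e = 2` plus
`ThetaGradedNegligible` at `e = 2` (`Θ^{(2)} = o(𝔓)`). [cite: Zhang2022LandauSiegel, §7 p.14 (7.4), §8 Lemma 8.1 p.16] -/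
theorem lhsGraded_two_approx (h81 : GradedLemma81 c') (hneg : ThetaGradedNegligible c') (B ε : ℝ) (hε : 0 < ε) :
    ForAllLarge fun D _ χ => AssumptionA D χ → ∀ a₁ a₂ : ℕ → ℂ, Adm72 D B a₁ → Adm72 D B a₂ →
      ‖lhsGraded c' χ 2 a₁ a₂ - conj (thetaGraded c' χ (-2) (fun n => conj (a₂ n)) (fun n => conj (a₁ n)))‖
        ≤ ε * frakP D := by
  have hε2 : 0 < ε / 2 := by positivity
  refine ((h81 2 B (ε / 2) hε2).and (hneg 2 le_rfl B (ε / 2) hε2)).mono fun D _ χ _ _ h hA a₁ a₂ h₁ h₂ => ?_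
  obtain ⟨hL, hN⟩ := h
  have e1 := hL hA a₁ a₂ h₁ h₂
  have e2 := hN hA a₁ a₂ h₁ h₂
  calc ‖lhsGraded c' χ 2 a₁ a₂ - conj (thetaGraded c' χ (-2) (fun n => conj (a₂ n)) (fun n => conj (a₁ n)))‖
      = ‖(lhsGraded c' χ 2 a₁ a₂ - (thetaGraded c' χ 2 a₁ a₂ +
            conj (thetaGraded c' χ (-2) (fun n => conj (a₂ n)) (fun n => conj (a₁ n))))) + thetaGraded c' χ 2 a₁ a₂‖ := by
          ring_nf
    _ ≤ ‖lhsGraded c' χ 2 a₁ a₂ - (thetaGraded c' χ 2 a₁ a₂ +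
            conj (thetaGraded c' χ (-2) (fun n => conj (a₂ n)) (fun n => conj (a₁ n))))‖ + ‖thetaGraded c' χ 2 a₁ a₂‖ :=
          norm_add_le _ _
    _ ≤ ε / 2 * frakP D + ε / 2 * frakP D := add_le_add e1 e2
    _ = ε * frakP D := by ring

/-- **Degree `−2`: the left side is the `Kl₃` half ITSELF (proved from the two OPEN Props):**
`‖lhs₋₂(𝐚₁,𝐚₂) − Θ^{(−2)}(𝐚₁,𝐚₂)‖ ≤ ε𝔓` eventually under (A) — `GradedLemma81` at `e = −2` plus `ThetaGradedNegligible` at `e = 2`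
applied to the conjugate-swapped data (tree `Section8aStatements.adm72_conj`). [cite: Zhang2022LandauSiegel, §7 p.14 (7.4), §8 Lemma 8.1 p.16] -/
theorem lhsGraded_neg_two_approx (h81 : GradedLemma81 c') (hneg : ThetaGradedNegligible c') (B ε : ℝ) (hε : 0 < ε) :
    ForAllLarge fun D _ χ => AssumptionA D χ → ∀ a₁ a₂ : ℕ → ℂ, Adm72 D B a₁ → Adm72 D B a₂ →
      ‖lhsGraded c' χ (-2) a₁ a₂ - thetaGraded c' χ (-2) a₁ a₂‖ ≤ ε * frakP D := by
  have hε2 : 0 < ε / 2 := by positivity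
  refine ((h81 (-2) B (ε / 2) hε2).and (hneg 2 le_rfl B (ε / 2) hε2)).mono fun D _ χ _ _ h hA a₁ a₂ h₁ h₂ => ?_
  obtain ⟨hL, hN⟩ := h
  have e1 := hL hA a₁ a₂ h₁ h₂
  -- (7.2) is conjugation-invariant (tree `Section8aStatements.adm72_conj`, restated inline to keep this file's imports)
  have hc : ∀ {a : ℕ → ℂ}, Adm72 D B a → Adm72 D B (fun n => conj (a n)) := fun h =>
    ⟨fun n => by rw [Complex.norm_conj]; exact h.1 n, fun n hn => by show conj (_ : ℂ) = 0; rw [h.2 n hn, map_zero]⟩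
  have e2 := hN hA (fun n => conj (a₂ n)) (fun n => conj (a₁ n)) (hc h₂) (hc h₁)
  rw [neg_neg] at e1
  have e2' : ‖conj (thetaGraded c' χ 2 (fun n => conj (a₂ n)) (fun n => conj (a₁ n)))‖ ≤ ε / 2 * frakP D := by
    rw [Complex.norm_conj]; exact e2
  calc ‖lhsGraded c' χ (-2) a₁ a₂ - thetaGraded c' χ (-2) a₁ a₂‖
      = ‖(lhsGraded c' χ (-2) a₁ a₂ - (thetaGraded c' χ (-2) a₁ a₂ +
            conj (thetaGraded c' χ 2 (fun n => conj (a₂ n)) (fun n => conj (a₁ n))))) +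
            conj (thetaGraded c' χ 2 (fun n => conj (a₂ n)) (fun n => conj (a₁ n)))‖ := by ring_nf
    _ ≤ ‖lhsGraded c' χ (-2) a₁ a₂ - (thetaGraded c' χ (-2) a₁ a₂ +
            conj (thetaGraded c' χ 2 (fun n => conj (a₂ n)) (fun n => conj (a₁ n))))‖ +
          ‖conj (thetaGraded c' χ 2 (fun n => conj (a₂ n)) (fun n => conj (a₁ n)))‖ := norm_add_le _ _
    _ ≤ ε / 2 * frakP D + ε / 2 * frakP D := add_le_add e1 e2'
    _ = ε * frakP D := by ring

end RightEdge

end Literature.NumberTheory.LFunctions.Zhang2022.KnifeEdge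

end
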